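import Literature.NumberTheory.Rogawski1990.CohDiscreteMemXiFamilyArchPinned   -- ★ #80 S2♯ `cohDiscrete_memXiFamily_archPinned` (+ ★ #70 S2♭ `cohDiscrete_memXiFamily` via `GlobalAPacketLetters`, ★ D6 `MemXiFamily`)
import HarnessLib

/-!
# ORGAN FIN OF THE LH1 PAY-DOWN ≤ S2♭ (#70) — `s2Fin_of_cohDiscrete_memXiFamily` (Theorems twin of the leaf's read-back `s2Fin_of_S2flat`)

Cell `hodgecm-mathlib`, FLOOR 0, crux H413 = `stmt-HodgeConjecture-24833`, route of record `HCCMUnconditional` (no route verbs); line LH1 (SEATPLAN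
«GO 500» v1 §1B; dealer LH1-plan (g0), DEALS ROUND 2, 2026-09-02T02:25:21Z, (δ) to LH1-p02).  Pay-down LEAF of record:
`Summits/HodgeConjecture/HodgeConjecture/Cruxes/H413/Lines/F0_P3c_S2SharpPaydown.lean` ED. 1 (commit e35a86fdfbd2, sha16 10355e03d0b94504) —
closer stub `stub_S2sharp : Literature.NumberTheory.Rogawski1990.cohDiscrete_memXiFamily_archPinned` (`Cruxes/H413/Lines/F0_U3LettersRung1.lean`
ED. 38 :64) ⟸ organs FIN `stub_S2fin : S2FinLetter` · PIN-ι `stub_S2pinIota : S2PinIotaLetter` · PIN-τ `stub_S2pinCompact : S2PinCompactLetter`.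
THEOREMS ONLY (no `def`, no instance, no notation, no named fact, no `sorry`); NO import of a `Cruxes/…/Lines` module (the organ text FIN is QUOTED
below as an explicit ∀-telescope, token for token the body of the leaf's `S2FinLetter` :84–:110, TYPE hash of record 4169104687 — LH-ref1 BOX LH1 #1);
`--supports stmt-HodgeConjecture-24833 --as helper`.

WHAT.  `s2Fin_of_cohDiscrete_memXiFamily : Rogawski1990.cohDiscrete_memXiFamily → ‹S2FinLetter text›` — ORGAN FIN (the finite-place half of #80 S2♯:
under the letter's hypotheses on `P` — cotangent type at the CM frame, `K_c`-trivial, a `(𝔤,K)`-token at `ι` into an irreducible module with a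
degree-one class of type `δ = ±1` — `∃ ξ, MemXiFamily P … μω hμu ξ`) is implied BY NAME by the print letter ★ #70 S2♭ `Rogawski1990.cohDiscrete_memXiFamily`
(`Literature/NumberTheory/Rogawski1990/GlobalAPacketLetters.lean` :68), whose antecedent is the WIDER class of token-cohomological `P` (no cotangency,
no `K_c`-triviality): forget the two extra hypotheses.  So the books may read «FIN ≤ #70 S2♭ restricted to cotangent, `K_c`-trivial `P`» BY THEOREM
(this file) rather than by the leaf's in-Lines read-back.  The companion «FIN ≤ #80 S2♯» (READ-BACK 1 ★ `cohDiscrete_memXiFamily_archPinned.memXiFamily`) is ★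
`F0P3cS2SharpOrgansOfS2Sharp.s2Fin_of_S2sharp` (LH1-p01) and is cited, not restated — #70 and #80 are the two print rows that dominate FIN.
PRINT ROAD of FIN itself (rung 5, not claimed here): a cotangent `P` has `H¹ ≠ 0` at `ι`, so `P_ι ∈ {J⁺_φ, J⁻_φ}` [Prop. 15.2.1 (b)] and `P` is of
type `Π′(ξ)` for a one-dimensional automorphic `ξ` of `H` [§15.3 ¶1, Thm. 13.3.6 (c), Thm. 14.6.4], whose finite local components are the packets
`Π(ξ_v)` of ★ `MemXiFamily` [§13.1 p. 199, §12.2 p. 174, Lemma 4.13.1 (b)].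

HONEST LABEL.  HC_CM is proved only modulo the 7 printed citations (2 remaining: hLiu418 = stmt-HodgeConjecture-24832, h413 = stmt-HodgeConjecture-24833)
until rung 0 closes; this file closes NO print letter (pure logic: FIN is a restriction of #70 and of #80).

## References
* [Rogawski1990] J. Rogawski, *Automorphic Representations of Unitary Groups in Three Variables*, Ann. of Math. Stud. 123 (1990): §14.6 pp. 241–244
  (Thm. 14.6.4 p. 243); §15.3 ¶1 (p. 249) and Thm. 13.3.6 (c) (p. 202); Prop. 15.2.1 (b) (p. 249); §13.1 p. 199; §12.2 p. 174; §4.13 Lemma 4.13.1 (b).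
* [BorelWallach2000] A. Borel, N. Wallach, *Continuous cohomology, discrete subgroups, and representations of reductive groups*, 2nd ed. (2000), VI Thm. 4.11.
-/

-- Mathlib idiom (as in ★ `GlobalAPacketLetters`, ★ `CohDiscreteMemXiFamilyArchPinned`, the LEAF): the commutator bracket on `Module.End ℂ M`,
-- needed to SPELL the binder `(uFormGroup (Fin 2) (Fin 1)).lie →ₗ⁅ℝ⁆ Module.End ℂ M` of the quoted organ text (not a global instance in this tree).
attribute [local instance 100] LieRing.ofAssociativeRing

set_option autoImplicit false
-- the mandated namespace repeats `HodgeConjecture.HodgeConjecture`, as in every `Theorems/*.lean` of this sub-problem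
set_option linter.dupNamespace false

noncomputable section

open NumberField IsDedekindDomain MeasureTheory
open Literature.NumberTheory.Rogawski1990 Literature.NumberTheory.GaloisRepresentations
open Literature.NumberTheory.Automorphic Literature.NumberTheory.Automorphic.UnitaryGroup
open Literature.NumberTheory.Automorphic.UnitaryGroup.CotangentForms
open Literature.RepresentationTheory.BorelWallach2000 Literature.RepresentationTheory.KonnoKonno2007
open scoped Matrix ComplexOrder

namespace Summit.HodgeConjecture.HodgeConjecture.Cruxes.H413.F0P3cS2FinOfS2Flat

/-- **ORGAN FIN ≤ #70 S2♭** — `Rogawski1990.cohDiscrete_memXiFamily → ‹S2FinLetter›` (the LEAF's organ text FIN, token for token): the print letter S2♭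
quantifies over every discrete `P` with a `(𝔤,K)`-token at `ι` into an irreducible module carrying a degree-one class of type `δ = ±1`; FIN adds the
hypotheses «`P` of (anti)holomorphic cotangent type» and «`K_c` acts trivially on `P`», which are simply not used.  (Theorems twin of the leaf's read-back
`F0P3cS2SharpPaydown.s2Fin_of_S2flat`; no Lines import.)
[cite: Rogawski1990, §14.6 Thm. 14.6.4 (p. 243); §15.3 ¶1 (p. 249); Thm. 13.3.6 (c) (p. 202); Prop. 15.2.1 (b) (p. 249); §13.1 p. 199; §12.2 p. 174; §4.13 Lemma 4.13.1 (b)]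
[cite: BorelWallach2000, VI Thm. 4.11] -/
theorem s2Fin_of_cohDiscrete_memXiFamily (h : Literature.NumberTheory.Rogawski1990.cohDiscrete_memXiFamily) :
    ∀ (L : Type) [Field L] [NumberField L] [IsCMField L] (ι : L →+* ℂ) (H : Matrix (Fin 3) (Fin 3) L) (T : GL (Fin 3) ℂ)
      (hT : (T : Matrix (Fin 3) (Fin 3) ℂ)ᴴ * H.map ι * (T : Matrix (Fin 3) (Fin 3) ℂ) = Literature.Geometry.ComplexHyperbolic.BallModel.J),
      (∀ τ' : L →+* ℂ, InfinitePlace.mk τ' ≠ InfinitePlace.mk ι → (H.map τ').PosDef) →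
      2 ≤ Module.finrank ℚ ↥(maximalRealSubfield L) →
      ∀ (μ : Measure (adelicGroupData (↥(maximalRealSubfield L)) L (IsCMField.complexConj L) 3 H).automorphicQuotient)
        [(adelicGroupData (↥(maximalRealSubfield L)) L (IsCMField.complexConj L) 3 H).IsAutomorphicMeasure μ]
        (μω : HeckeCharacter L) (hμu : μω.IsUnitary),
        (∀ x : Literature.NumberTheory.GaloisRepresentations.ideleGroup ↥(maximalRealSubfield L),
          μω (AdeleRing.ideleBaseChange (↥(maximalRealSubfield L)) L x) = quadraticHeckeCharCM L x) →
      ∀ (P : DiscreteAutomorphicRep (adelicGroupData (↥(maximalRealSubfield L)) L (IsCMField.complexConj L) 3 H) μ),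
        (P.IsHolCotangentAt (cmArchSection L ι H T hT) (cmCompactFactor L ι H T hT) ∨
          P.IsAntiholCotangentAt (cmArchSection L ι H T hT) (cmCompactFactor L ι H T hT)) →
        (∀ k : (adelicGroupData (↥(maximalRealSubfield L)) L (IsCMField.complexConj L) 3 H).Adelic, k ∈ cmCompactFactor L ι H T hT →
          ∀ v : P.space.toSubmodule, (adelicGroupData (↥(maximalRealSubfield L)) L (IsCMField.complexConj L) 3 H).rightRegular μ k
            (v : (adelicGroupData (↥(maximalRealSubfield L)) L (IsCMField.complexConj L) 3 H).L2 μ) = v) →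
        ∀ (M : Type) [AddCommGroup M] [Module ℂ M]
          (σK : Representation ℂ (uFormGroup (Fin 2) (Fin 1)).maximalCompact M) (σ𝔤 : (uFormGroup (Fin 2) (Fin 1)).lie →ₗ⁅ℝ⁆ Module.End ℂ M)
          (hM : IsGKModule (uFormGroup (Fin 2) (Fin 1)) σK σ𝔤), IsIrreducibleGK σK σ𝔤 →
          (∃ T₁ : P.archModuleCM ι T hT →ₗ[ℂ] M,
            (∀ (k : (uFormGroup (Fin 2) (Fin 1)).maximalCompact) (w : P.archModuleCM ι T hT), T₁ (P.archRepKCM ι T hT k w) = σK k (T₁ w)) ∧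
              (∀ (X : (uFormGroup (Fin 2) (Fin 1)).lie) (w : P.archModuleCM ι T hT), T₁ (P.archRepLieCM ι T hT X w) = σ𝔤 X (T₁ w)) ∧ T₁ ≠ 0) →
          ∀ δ : ℤ, (δ = 1 ∨ δ = -1) → upqTypeClasses σK σ𝔤 hM.ad_compat 1 δ ≠ ⊥ →
            ∃ ξ : OneDimAutRepH L,
              MemXiFamily P (transpose_map_cmConjRingHom_eq_of_frame L ι H T hT) (isUnit_det_of_frame L ι H T hT) μω hμu ξ :=
  fun L _ _ _ ι H T hT hdef h2 μ _ μω hμu hμω P _ _ M _ _ σK σ𝔤 hM hirr htok δ hδ hne =>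
    h L ι H T hT hdef h2 μ μω hμu hμω P M σK σ𝔤 hM hirr htok δ hδ hne

-- ORGAN FIN ≤ #80 S2♯ (`cohDiscrete_memXiFamily_archPinned → ‹S2FinLetter›`, READ-BACK 1) is ★ ALREADY, by name:
-- `Summit.HodgeConjecture.HodgeConjecture.Cruxes.H413.F0P3cS2SharpOrgansOfS2Sharp.s2Fin_of_S2sharp` (LH1-p01's equivalence certificate) — not restated here.

end Summit.HodgeConjecture.HodgeConjecture.Cruxes.H413.F0P3cS2FinOfS2Flat

end
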